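import Literature.AnabelianGeometry.SemiGraphs.TemperedGroups
import Mathlib.CategoryTheory.Limits.FullSubcategory
import Mathlib.CategoryTheory.Limits.Types.Limits
import Mathlib.CategoryTheory.Limits.Types.Colimits
import Mathlib.CategoryTheory.Action.Limits
import Mathlib.CategoryTheory.Countable
import HarnessLib

/-!
# Semi-graphs of anabelioids, §3: finite limits and countable colimits in `B^temp(Π)`

Mochizuki, *Semi-graphs of anabelioids*, Publ. RIMS **42** (2006), §3, Definition 3.1 (iii) p. 33
[cite: MochizukiSemiAnbd2006, Def 3.1(iii) p.33]: a morphism of temperoids is "a functor … that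
preserves finite limits and countable colimits" — so a temperoid, in particular `B^temp(Π)`, is
used as a category possessing these.  This proof-only file verifies it for
`B^temp(Π) = BTemp Π` (countable discrete continuous `Π`-sets, a full subcategory of
`Action (Type u) Π`):

* `BTemp.isClosedUnderLimitsOfShape_of_finCategory` — "countable with open stabilisers" is closed
  under finite limits in `Action (Type u) Π` (a limit cone is jointly injective on points: the
  limit embeds in a finite product of countable sets, and a stabiliser contains the finite
  intersection of the open stabilisers of the projections); hence `BTemp.hasFiniteLimits`;
* `BTemp.isClosedUnderColimitsOfShape_of_countable` — closed under colimits of any countable shape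
  (jointly surjective cocones); hence `BTemp.hasColimitsOfShape_of_countable`;
* the inclusion followed by the forgetful functor preserves these (co)limits
  (`BTemp.preservesLimitsOfShape_forget`, `BTemp.preservesColimitsOfShape_forget`), i.e. they are
  computed on underlying sets.

Proof-only: no definitions.  (Countable coproducts specifically: `BTempCoproductsProofs.lean`.)
-/

namespace Literature.AnabelianGeometry.SemiGraphs

open CategoryTheory CategoryTheory.Limits Topology

universe u

variable {G : Type u} [Group G] [TopologicalSpace G] [IsTopologicalGroup G]

omit [TopologicalSpace G] [IsTopologicalGroup G] in
/-- Equivariance of a morphism of `Π`-sets, pointwise. [folklore] -/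
private theorem hom_ρ₀ {X Y : Action (Type u) G} (f : X ⟶ Y) (g : G) (x : X.V) :
    f.hom (X.ρ g x) = Y.ρ g (f.hom x) := by
  have e := ConcreteCategory.congr_hom (f.comm g) x
  simp only [types_comp_apply] at e
  exact e

/-- **Finite limits exist in `B^temp(Π)` and are computed in `Π`-sets**: the property "countable
with open stabilisers" is closed under finite limits in `Action (Type u) Π`.
[cite: MochizukiSemiAnbd2006, Def 3.1(iii) p.33] -/
theorem BTemp.isClosedUnderLimitsOfShape_of_finCategory (J : Type) [SmallCategory J] [FinCategory J] :
    ObjectProperty.IsClosedUnderLimitsOfShape (temperedAction G) J := by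
  refine ⟨fun X hX => ?_⟩
  obtain ⟨p⟩ := hX
  have hc := isLimitOfPreserves (Action.forget (Type u) G) p.isLimit
  -- the cone is jointly injective on points
  have hinj : ∀ x y : X.V, (∀ j, (p.π.app j).hom x = (p.π.app j).hom y) → x = y := by
    intro x y h
    apply (Types.isLimitEquivSections hc).injective
    apply Subtype.ext
    funext j
    exact h j
  refine ⟨?_, fun x => ?_⟩
  · -- countable: embeds in the finite product of the countable `X_j`
    haveI : ∀ j : J, Countable (p.diag.obj j).V := fun j => (p.prop_diag_obj j).1
    have hf : Function.Injective (fun x : X.V => fun j : J => ((p.π.app j).hom x : (p.diag.obj j).V)) :=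
      fun x y h => hinj x y fun j => congrFun h j
    exact hf.countable
  · -- open stabilisers
    letI iX : MulAction G X.V := Action.instMulAction X
    letI iD : ∀ j, MulAction G (p.diag.obj j).V := fun j => Action.instMulAction (p.diag.obj j)
    let xs : ∀ j : J, (p.diag.obj j).V := fun j => (p.π.app j).hom x
    have hle : (⨅ j, MulAction.stabilizer G (xs j)) ≤ MulAction.stabilizer G x := by
      intro g hg
      rw [Subgroup.mem_iInf] at hg
      rw [MulAction.mem_stabilizer_iff]
      apply hinj
      intro j
      exact (hom_ρ₀ (p.π.app j) g x).trans (MulAction.mem_stabilizer_iff.mp (hg j))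
    have hopen : IsOpen ((⨅ j, MulAction.stabilizer G (xs j) : Subgroup G) : Set G) := by
      rw [Subgroup.coe_iInf]
      exact isOpen_iInter_of_finite fun j => (p.prop_diag_obj j).2 (xs j)
    exact Subgroup.isOpen_mono hle hopen

/-- **Countable colimits exist in `B^temp(Π)` and are computed in `Π`-sets**: the property
"countable with open stabilisers" is closed under colimits of every countable shape in
`Action (Type u) Π`. [cite: MochizukiSemiAnbd2006, Def 3.1(iii) p.33] -/
theorem BTemp.isClosedUnderColimitsOfShape_of_countable (J : Type) [SmallCategory J] [Countable J] :
    ObjectProperty.IsClosedUnderColimitsOfShape (temperedAction G) J := by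
  refine ⟨fun X hX => ?_⟩
  obtain ⟨p⟩ := hX
  have hc := isColimitOfPreserves (Action.forget (Type u) G) p.isColimit
  have hsurj : ∀ x : X.V, ∃ (j : J) (y : (p.diag.obj j).V), (p.ι.app j).hom y = x := by
    intro x
    obtain ⟨j, y, hy⟩ := Types.jointly_surjective_of_isColimit hc x
    exact ⟨j, y, hy⟩
  refine ⟨?_, fun x => ?_⟩
  · haveI : ∀ j : J, Countable (p.diag.obj j).V := fun j => (p.prop_diag_obj j).1
    have hf : Function.Surjective
        (fun q : (Σ j : J, (p.diag.obj j).V) => (show X.V from (p.ι.app q.1).hom q.2)) := by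
      intro x
      obtain ⟨j, y, hy⟩ := hsurj x
      exact ⟨⟨j, y⟩, hy⟩
    exact hf.countable
  · obtain ⟨j, y, rfl⟩ := hsurj x
    letI i₁ : MulAction G (p.diag.obj j).V := Action.instMulAction (p.diag.obj j)
    letI i₂ : MulAction G X.V := Action.instMulAction X
    let x' : X.V := (p.ι.app j).hom y
    have hle : MulAction.stabilizer G y ≤ MulAction.stabilizer G x' := by
      intro g hg
      rw [MulAction.mem_stabilizer_iff] at hg ⊢
      exact ((hom_ρ₀ (p.ι.app j) g y).symm.trans
        (congrArg (fun z => (show X.V from (p.ι.app j).hom z)) hg))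
    have hopen : IsOpen (MulAction.stabilizer G x' : Set G) :=
      Subgroup.isOpen_mono hle ((p.prop_diag_obj j).2 y)
    exact hopen

/-- **`B^temp(Π)` has finite limits.** [cite: MochizukiSemiAnbd2006, Def 3.1(iii) p.33] -/
theorem BTemp.hasLimitsOfShape_of_finCategory (J : Type) [SmallCategory J] [FinCategory J] :
    HasLimitsOfShape J (BTemp G) := by
  haveI := BTemp.isClosedUnderLimitsOfShape_of_finCategory (G := G) J
  exact hasLimitsOfShape_of_closedUnderLimits J (temperedAction G)

/-- **`B^temp(Π)` has finite limits** (as a `HasFiniteLimits` instance-fact).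
[cite: MochizukiSemiAnbd2006, Def 3.1(iii) p.33] -/
theorem BTemp.hasFiniteLimits : HasFiniteLimits (BTemp G) :=
  ⟨fun J _ _ => BTemp.hasLimitsOfShape_of_finCategory J⟩

/-- **`B^temp(Π)` has colimits of every countable shape.** [cite: MochizukiSemiAnbd2006, Def 3.1(iii) p.33] -/
theorem BTemp.hasColimitsOfShape_of_countable (J : Type) [SmallCategory J] [Countable J] :
    HasColimitsOfShape J (BTemp G) := by
  haveI := BTemp.isClosedUnderColimitsOfShape_of_countable (G := G) J
  exact hasColimitsOfShape_of_closedUnderColimits J (temperedAction G)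

/-- Finite limits of `B^temp(Π)` are computed on underlying sets: the forgetful functor
`B^temp(Π) ⥤ Type` preserves them. [cite: MochizukiSemiAnbd2006, Def 3.1(iii) p.33] -/
theorem BTemp.preservesLimitsOfShape_forget (J : Type) [SmallCategory J] [FinCategory J] :
    PreservesLimitsOfShape J ((temperedAction G).ι ⋙ Action.forget (Type u) G) := by
  haveI := BTemp.isClosedUnderLimitsOfShape_of_finCategory (G := G) J
  infer_instance

/-- Countable colimits of `B^temp(Π)` are computed on underlying sets: the forgetful functor
`B^temp(Π) ⥤ Type` preserves them. [cite: MochizukiSemiAnbd2006, Def 3.1(iii) p.33] -/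
theorem BTemp.preservesColimitsOfShape_forget (J : Type) [SmallCategory J] [Countable J] :
    PreservesColimitsOfShape J ((temperedAction G).ι ⋙ Action.forget (Type u) G) := by
  haveI := BTemp.isClosedUnderColimitsOfShape_of_countable (G := G) J
  infer_instance

end Literature.AnabelianGeometry.SemiGraphs
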